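import Literature.Computability.Cryptography.VanDamSeroussiCubicCombine
import HarnessLib

/-!
# The quantum block of the cubic Gauss-sum experiment, IX: the coins

Topic `Literature/Computability/Cryptography`; sequel of `VanDamSeroussiCubicCombine.lean`. The block
puts its two coin registers — the coset index `c' ∈ {0,…,3}` on `CPreg` and the cosine/sine switch
`τ` — in uniform superposition and never touches them again, so its output is the superposition
`2^{-3/2} Σ_{c',τ} Φ_{(c',τ)}` of the eight component states (`blockCirc_mulVec`), the components
are carried by labels showing their own coin values (`Φ_apply_ne_zero`), and therefore the
probability of reading coins `(c', τ)`, control `b` and a test event is `Pb/8` of that component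
(`sum_coin_event_eq`). Everything here is proved; no named fact is introduced.

## References

* W. van Dam, G. Seroussi, arXiv:quant-ph/0207131 (2002), §4 Thm. 1 (proof) [VanDamSeroussi2002].
-/

noncomputable section

namespace Literature.Computability.Cryptography

namespace VanDamSeroussi

namespace CubicBlock

open _root_.Computability Complexity QuantumComplexity QuantumComplexity.RevSim QuantumComplexity.RevClean Kitaev1995 Finset Matrix

namespace Layout

variable (Λ : Layout)

/-! ### The coin wires on the labels of a component -/

/-- `w` shows the coin values of the component `d`. [folklore] -/
def CoinOK (d : Data) (w : QReg Λ.Wd) : Prop :=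
  (∀ i, i < 2 → w (Λ.fin (Λ.CPreg 0 + i)) = d.cp.testBit i) ∧ w (Λ.fin Λ.tau) = d.im

/-- The coin wires lie in the first part, off the control, the flag and the `X` register. [folklore] -/
theorem coin_facts : Λ.CPreg 0 + 1 < Λ.n₁ ∧ Λ.tau < Λ.n₁ ∧ Λ.c < Λ.CPreg 0 ∧ Λ.f < Λ.CPreg 0 ∧ Λ.X 0 + Λ.n < Λ.CPreg 0 ∧
    Λ.J 0 + Λ.lam ≤ Λ.CPreg 0 ∧ Λ.tau < Λ.c ∧ Λ.c < Λ.X 0 ∧ Λ.c < Λ.J 0 ∧ Λ.c < Λ.f := by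
  have h1 := Λ.CP0_add_le; have h2 := Λ.as_le_n₁; have h3 := Λ.lt_cs_facts
  refine ⟨by omega, Λ.tau_lt_n₁, ?_, ?_, ?_, ?_, Λ.tau_lt_c, ?_, ?_, ?_⟩ <;> simp only [c, f, X, J, CPreg, cs] <;> omega

/-- The component first part shows its coins. [folklore] -/
theorem x₀_coinOK (d : Data) :
    (∀ i (hi : i < 2), Λ.x₀ d ⟨Λ.CPreg 0 + i, by have := Λ.coin_facts.1; omega⟩ = d.cp.testBit i) ∧
      Λ.x₀ d ⟨Λ.tau, Λ.tau_lt_n₁⟩ = d.im := by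
  refine ⟨fun i hi => ?_, Λ.cx_tau d⟩
  have : Λ.CPreg 0 + i = Λ.CPreg i := by unfold CPreg; omega
  simp only [this]
  exact Λ.cx_CPreg d hi _

/-- So does `x₁`. [folklore] -/
theorem x₁_coin (d : Data) {q : ℕ} (hq : q = Λ.CPreg 0 ∨ q = Λ.CPreg 0 + 1 ∨ q = Λ.tau) (h : q < Λ.n₁) :
    Λ.x₁ d ⟨q, h⟩ = Λ.x₀ d ⟨q, h⟩ :=
  Λ.x₁_of_ne_c (by have := Λ.coin_facts; omega) h

/-- So does `xJ`. [folklore] -/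
theorem xJ_coin (d : Data) (s : ℕ) {q : ℕ} (hq : q = Λ.CPreg 0 ∨ q = Λ.CPreg 0 + 1 ∨ q = Λ.tau) (h : q < Λ.n₁) :
    Λ.xJ d s ⟨q, h⟩ = Λ.x₀ d ⟨q, h⟩ := by
  have hf := Λ.coin_facts
  have hqf : q ≠ Λ.f := by rcases hq with rfl | rfl | rfl <;> omega
  have hqX : ¬(Λ.X 0 ≤ q ∧ q < Λ.X 0 + Λ.n) := by rcases hq with rfl | rfl | rfl <;> omega
  rw [xJ, xf, Function.update_of_ne (fun h' => by simp only [Fin.mk.injEq] at h'; exact hqf h'), xX, Λ.setReg_of_not _ _ hqX]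
  exact Λ.x₁_coin d hq h

/-- The repetition stage does not touch the coin wires. [folklore] -/
theorem rmap_fin_coin (x : QReg Λ.n₁) (jv : ℕ) {q : ℕ} (hq : q = Λ.CPreg 0 ∨ q = Λ.CPreg 0 + 1 ∨ q = Λ.tau) (h : q < Λ.n₁) :
    Λ.rmap x jv (Λ.fin q) = x ⟨q, h⟩ := by
  have hf := Λ.coin_facts
  have has := Λ.as_le_n₁; have hW := Λ.n₁_le_Wd
  have hqJ : ¬(Λ.J 0 ≤ q ∧ q < Λ.J 0 + Λ.lam) := by rcases hq with rfl | rfl | rfl <;> omega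
  have hqX : ∀ i, i < Λ.n → q ≠ Λ.X i := fun i hi => by unfold X; rcases hq with rfl | rfl | rfl <;> unfold X at hf <;> omega
  have hqJ' : ∀ i, i < Λ.lam → q ≠ Λ.J i := fun i hi => by unfold J; rcases hq with rfl | rfl | rfl <;> unfold J at hf <;> omega
  unfold rmap
  rw [PXor.clEval_ops_of_ne Λ.geom₃ _ _ fun j hj h' => ?_, PXor.clEval_ops_of_ne Λ.geom₂ _ _ fun j hj h' => ?_,
    Λ.tri_fin_of_lt _ _ _ h, Λ.setReg_of_not _ _ hqJ]
  · have := congrArg Fin.val h'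
    rw [CleanXor.tgt, fin, val_finOf_of_lt _ (by omega), val_finOf_of_lt _ (Λ.Y_lt_Wd hj)] at this
    have := Λ.n₁_le_Y j; omega
  · have := congrArg Fin.val h'
    have htlt : Λ.tXJ j < Λ.n₁ := by
      unfold tXJ; split_ifs with h''
      · have := Λ.X_lt_as h''; omega
      · have := Λ.J_lt_as (i := j - Λ.n) (by omega); omega
    rw [CleanXor.tgt, fin, val_finOf_of_lt _ (by omega), val_finOf_of_lt _ (by omega)] at this
    revert this; unfold tXJ; split_ifs with h''
    · exact hqX j h''
    · exact hqJ' (j - Λ.n) (by omega)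

/-- **The good part is carried by labels showing the coins.** [folklore] -/
theorem goodVec_apply_ne_zero {d : Data} (hd : Λ.DataOK d) {w : QReg Λ.Wd} (hw : Λ.goodVec d w ≠ 0) : Λ.CoinOK d w := by
  rw [Λ.goodVec_eq_sum hd, Finset.sum_apply] at hw
  obtain ⟨q, -, hq⟩ := Finset.exists_ne_zero_of_sum_ne_zero hw
  rw [Pi.smul_apply, basisState_apply] at hq
  have hwl : w = Λ.gl d q.1 q.2.1 q.2.2 := by by_contra h; rw [if_neg h, smul_zero] at hq; exact hq rfl
  obtain ⟨hx, hτ⟩ := Λ.x₀_coinOK d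
  have hf := Λ.coin_facts
  have hxb : ∀ {q' : ℕ} (hq' : q' = Λ.CPreg 0 ∨ q' = Λ.CPreg 0 + 1 ∨ q' = Λ.tau) (h : q' < Λ.n₁),
      Λ.xb d q.1 ⟨q', h⟩ = Λ.x₀ d ⟨q', h⟩ := by
    intro q' hq' h; unfold xb; split_ifs
    · exact Λ.x₁_coin d hq' h
    · rfl
  refine ⟨fun i hi => ?_, ?_⟩
  · have h : Λ.CPreg 0 + i < Λ.n₁ := by omega
    rw [hwl, gl, Λ.tri_fin_of_lt _ _ _ h, hxb (by interval_cases i <;> simp) h]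
    exact hx i hi
  · rw [hwl, gl, Λ.tri_fin_of_lt _ _ _ Λ.tau_lt_n₁, hxb (Or.inr (Or.inr rfl))]
    exact hτ

/-- **The junk part is carried by labels showing the coins.** [folklore] -/
theorem junkVec_apply_ne_zero (d : Data) {w : QReg Λ.Wd} (hw : Λ.junkVec d w ≠ 0) : Λ.CoinOK d w := by
  classical
  have hf := Λ.coin_facts
  rw [Λ.junkVec_eq] at hw
  have hnorm := Λ.norm_read_apply (Λ.ψJ d) (fun z hz => Λ.ψJ_apply_eq_zero d z (Or.inl hz)) w
  have hψ : Λ.ψJ d (Function.update w (Λ.fin Λ.c) true) ≠ 0 := by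
    intro h0; rw [h0, norm_zero, mul_zero, norm_eq_zero] at hnorm; exact hw hnorm
  set w' := Function.update w (Λ.fin Λ.c) true with hw'
  -- some `(s, jv)` term is non-zero at `w'`
  rw [ψJ, Pi.smul_apply, Finset.sum_apply, smul_eq_mul] at hψ
  obtain ⟨s, -, hs⟩ := Finset.exists_ne_zero_of_sum_ne_zero (right_ne_zero_of_mul hψ)
  rw [Finset.sum_apply] at hs
  obtain ⟨jv, -, hjv⟩ := Finset.exists_ne_zero_of_sum_ne_zero hs
  obtain ⟨hparts, -, -⟩ := Λ.rmap_xJ_parts d s jv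
  set z := Λ.rmap (Λ.xJ d s) jv with hz
  rw [hparts, Λ.peCirc_mulVec_tri] at hjv
  simp only [Pi.smul_apply, Finset.sum_apply, smul_eq_mul, basisState_apply, mul_ite, mul_one, mul_zero] at hjv
  obtain ⟨y, -, hy⟩ := Finset.exists_ne_zero_of_sum_ne_zero (right_ne_zero_of_mul hjv)
  obtain ⟨y', -, hy'⟩ := Finset.exists_ne_zero_of_sum_ne_zero hy
  have hwl : w' = tri (fun i => z (Fin.castAdd _ i)) y' (Λ.A (fun i => z (Fin.castAdd _ i)) y fun l => z (Fin.natAdd Λ.n₁ (Fin.natAdd Λ.k l))) := by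
    by_contra h; exact hy' (if_neg h)
  -- read a coin wire `q` of `w` through `w'` and `z`
  have key : ∀ {q : ℕ} (hq : q = Λ.CPreg 0 ∨ q = Λ.CPreg 0 + 1 ∨ q = Λ.tau) (h : q < Λ.n₁), w (Λ.fin q) = Λ.x₀ d ⟨q, h⟩ := by
    intro q hq h
    have hne : Λ.fin q ≠ Λ.fin Λ.c := fun h' => by
      have := congrArg Fin.val h'
      rw [fin, fin, val_finOf_of_lt _ (by have := Λ.n₁_le_Wd; omega), val_finOf_of_lt _ (by have := Λ.n₁_le_Wd; have := Λ.c_lt_n₁; omega)] at this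
      omega
    have : w (Λ.fin q) = w' (Λ.fin q) := by rw [hw', Function.update_of_ne hne]
    rw [this, hwl, Λ.tri_fin_of_lt _ _ _ h, ← Λ.xJ_coin d s hq h, ← Λ.rmap_fin_coin (Λ.xJ d s) jv hq h, fin,
      finOf_of_lt _ (by have := Λ.n₁_le_Wd; omega)]
    rfl
  obtain ⟨hx, hτ⟩ := Λ.x₀_coinOK d
  exact ⟨fun i hi => by rw [key (by interval_cases i <;> simp) (by omega)]; exact hx i hi,
    by rw [key (Or.inr (Or.inr rfl)) Λ.tau_lt_n₁]; exact hτ⟩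

/-- **A component is carried by labels showing its coins.** [cite: VanDamSeroussi2002, §4 Thm. 1 (proof)] -/
theorem Φ_apply_ne_zero {d : Data} (hd : Λ.DataOK d) (hp : 0 < d.p) {w : QReg Λ.Wd} (hw : Λ.Φ d w ≠ 0) : Λ.CoinOK d w := by
  rw [Λ.Φ_eq hd hp, Pi.add_apply] at hw
  by_cases hg : Λ.goodVec d w = 0
  · rw [hg, zero_add] at hw; exact Λ.junkVec_apply_ne_zero d hw
  · exact Λ.goodVec_apply_ne_zero hd hg

/-! ### The block output is the superposition of the eight components -/

/-- The stages after the constants-and-coins stage. [folklore] -/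
def restCirc : QCircuit cliffordT Λ.Wd := Λ.prepCirc.append (Λ.repCirc.append (Λ.peCirc.append Λ.readCirc))

/-- The rest of the block on a component label is the component state. [folklore] -/
theorem restCirc_mulVec (d : Data) :
    Λ.restCirc.toMatrix 0 *ᵥ basisState (tri (Λ.cx d) (fun _ : Fin Λ.k => false) (fun _ : Fin (Λ.kap + Λ.kap) => false)) = Λ.Φ d := by
  rw [restCirc, QCircuit.toMatrix_append, QCircuit.toMatrix_append, QCircuit.toMatrix_append, ← Matrix.mulVec_mulVec,
    ← Matrix.mulVec_mulVec, ← Matrix.mulVec_mulVec]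
  rfl

/-- **The block output on the input `(p, r)` is `2^{-3/2} Σ_{c'<4, τ} Φ_{(p,r,c',τ)}`.**
[cite: VanDamSeroussi2002, §4 Thm. 1 (proof)] -/
theorem blockCirc_mulVec (d : Data) :
    Λ.blockCirc.toMatrix 0 *ᵥ basisState (tri (Λ.xIn d) (fun _ : Fin Λ.k => false) (fun _ : Fin (Λ.kap + Λ.kap) => false)) =
      (invSqrt2 ^ 2 * invSqrt2) • ∑ cp ∈ range 4, (Λ.Φ ⟨d.p, d.r, cp, false⟩ + Λ.Φ ⟨d.p, d.r, cp, true⟩) := by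
  rw [show Λ.blockCirc = Λ.constCirc.append Λ.restCirc from rfl, QCircuit.toMatrix_append, ← Matrix.mulVec_mulVec,
    Λ.constCirc_mulVec, Matrix.mulVec_smul, Matrix.mulVec_sum]
  congr 1
  refine sum_congr rfl fun cp _ => ?_
  rw [Matrix.mulVec_add, Λ.restCirc_mulVec, Λ.restCirc_mulVec]

/-- `‖2^{-3/2}‖² = 1/8`. [folklore] -/
theorem norm_sq_coinAmp : ‖(invSqrt2 ^ 2 * invSqrt2 : ℂ)‖ ^ 2 = 1 / 8 := by
  rw [show (invSqrt2 ^ 2 * invSqrt2 : ℂ) = invSqrt2 ^ 3 by ring, norm_invSqrt2_pow_sq]; norm_num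

/-- Coin values are determined by the coin wires. [folklore] -/
theorem coinOK_unique {d d' : Data} (hcp : d.cp < 4) (hcp' : d'.cp < 4) {w : QReg Λ.Wd} (h : Λ.CoinOK d w) (h' : Λ.CoinOK d' w) :
    d.cp = d'.cp ∧ d.im = d'.im := by
  obtain ⟨hb, hτ⟩ := h
  obtain ⟨hb', hτ'⟩ := h'
  refine ⟨?_, by rw [← hτ, ← hτ']⟩
  have h0 := (hb 0 (by norm_num)).symm.trans (hb' 0 (by norm_num))
  have h1 := (hb 1 (by norm_num)).symm.trans (hb' 1 (by norm_num))
  refine Nat.eq_of_testBit_eq fun i => ?_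
  rcases Nat.lt_or_ge i 2 with hi | hi
  · interval_cases i
    · exact h0
    · exact h1
  · rw [Nat.testBit_eq_false_of_lt (lt_of_lt_of_le hcp (by calc 4 = 2 ^ 2 := by norm_num
        _ ≤ 2 ^ i := Nat.pow_le_pow_right (by norm_num) hi)),
      Nat.testBit_eq_false_of_lt (lt_of_lt_of_le hcp' (by calc 4 = 2 ^ 2 := by norm_num
        _ ≤ 2 ^ i := Nat.pow_le_pow_right (by norm_num) hi))]

/-- **On a label showing coins `(c', τ)` only that component is present**: the block output there is
`2^{-3/2} Φ_{(c',τ)}`. [cite: VanDamSeroussi2002, §4 Thm. 1 (proof)] -/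
theorem blockCirc_apply_of_coinOK {p r cp : ℕ} {im : Bool} (hp : 0 < p) (hpn : p < 2 ^ Λ.n) (hrn : r < 2 ^ Λ.n) (hcp : cp < 4)
    {w : QReg Λ.Wd} (hw : Λ.CoinOK ⟨p, r, cp, im⟩ w) :
    (Λ.blockCirc.toMatrix 0 *ᵥ basisState (tri (Λ.xIn ⟨p, r, 0, false⟩) (fun _ : Fin Λ.k => false)
      (fun _ : Fin (Λ.kap + Λ.kap) => false))) w = (invSqrt2 ^ 2 * invSqrt2) * Λ.Φ ⟨p, r, cp, im⟩ w := by
  rw [Λ.blockCirc_mulVec, Pi.smul_apply, smul_eq_mul]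
  congr 1
  rw [Finset.sum_apply, Finset.sum_eq_single_of_mem cp (mem_range.2 hcp) fun cp' hcp' hne => ?_]
  · rw [Pi.add_apply]
    cases im
    · rw [add_eq_left]
      by_contra h
      have := Λ.coinOK_unique (d := ⟨p, r, cp, false⟩) (d' := ⟨p, r, cp, true⟩) hcp hcp hw (Λ.Φ_apply_ne_zero ⟨hpn, hrn, hcp⟩ hp h)
      exact Bool.false_ne_true this.2
    · rw [add_eq_right]
      by_contra h
      have := Λ.coinOK_unique (d := ⟨p, r, cp, true⟩) (d' := ⟨p, r, cp, false⟩) hcp hcp hw (Λ.Φ_apply_ne_zero ⟨hpn, hrn, hcp⟩ hp h)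
      exact Bool.false_ne_true this.2.symm
  · have hcp'4 := mem_range.1 hcp'
    rw [Pi.add_apply]
    have h0 : Λ.Φ ⟨p, r, cp', false⟩ w = 0 := by
      by_contra h
      exact hne (Λ.coinOK_unique (d := ⟨p, r, cp', false⟩) (d' := ⟨p, r, cp, im⟩) hcp'4 hcp (Λ.Φ_apply_ne_zero ⟨hpn, hrn, hcp'4⟩ hp h) hw).1
    have h1 : Λ.Φ ⟨p, r, cp', true⟩ w = 0 := by
      by_contra h
      exact hne (Λ.coinOK_unique (d := ⟨p, r, cp', true⟩) (d' := ⟨p, r, cp, im⟩) hcp'4 hcp (Λ.Φ_apply_ne_zero ⟨hpn, hrn, hcp'4⟩ hp h) hw).1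
    rw [h0, h1, add_zero]

/-- **The probability of a coin-control-tests event is `Pb/8` of the component.** For coins
`(c', τ)`, control value `b` and a test event `T`:
`Σ_{w : coins = (c',τ), control = b, T(tests)} |ψ(w)|² = Pb_{(c',τ)}(b, T) / 8`.
[cite: VanDamSeroussi2002, §4 Thm. 1 (proof)] -/
theorem sum_coin_event_eq {p r cp : ℕ} {im : Bool} (hp : 0 < p) (hpn : p < 2 ^ Λ.n) (hrn : r < 2 ^ Λ.n) (hcp : cp < 4)
    (b : Bool) (T : QReg Λ.k → Prop) [DecidablePred T] [DecidablePred (Λ.CoinOK ⟨p, r, cp, im⟩)] :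
    ∑ w ∈ univ.filter (fun w : QReg Λ.Wd => Λ.CoinOK ⟨p, r, cp, im⟩ w ∧ w (Λ.fin Λ.c) = b ∧ T (Λ.testsOf w)),
      ‖(Λ.blockCirc.toMatrix 0 *ᵥ basisState (tri (Λ.xIn ⟨p, r, 0, false⟩) (fun _ : Fin Λ.k => false)
        (fun _ : Fin (Λ.kap + Λ.kap) => false))) w‖ ^ 2 = Λ.Pb ⟨p, r, cp, im⟩ b T / 8 := by
  rw [Pb, eq_div_iff (by norm_num), Finset.sum_mul]
  -- drop the coin condition on the right: off it the component vanishes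
  rw [← Finset.sum_filter_add_sum_filter_not (univ.filter fun w : QReg Λ.Wd => w (Λ.fin Λ.c) = b ∧ T (Λ.testsOf w))
    (fun w => Λ.CoinOK ⟨p, r, cp, im⟩ w), Finset.sum_eq_zero (s := (univ.filter fun w : QReg Λ.Wd =>
      w (Λ.fin Λ.c) = b ∧ T (Λ.testsOf w)).filter fun w => ¬Λ.CoinOK ⟨p, r, cp, im⟩ w) (fun w hw => by
        have hw' := (Finset.mem_filter.1 hw).2
        rw [show Λ.Φ ⟨p, r, cp, im⟩ w = 0 from by_contra fun h => hw' (Λ.Φ_apply_ne_zero ⟨hpn, hrn, hcp⟩ hp h)]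
        simp), add_zero, Finset.filter_filter]
  refine Finset.sum_congr (Finset.filter_congr fun w _ => by tauto) fun w hw => ?_
  rw [Λ.blockCirc_apply_of_coinOK hp hpn hrn hcp (Finset.mem_filter.1 hw).2.2, norm_mul, mul_pow, norm_sq_coinAmp]
  ring

end Layout


end CubicBlock

end VanDamSeroussi

end Literature.Computability.Cryptography
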